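import Literature.Topology.FourManifolds.HandleAttachingMapsLocality
import Literature.Topology.FourManifolds.HandleAttachingMapsSymmetry
import Literature.Topology.FourManifolds.BallStretch
import HarnessLib

/-!
# Shrinking attaching maps towards their attaching spheres

Topic `Literature/Topology/FourManifolds`; a proofs-and-plumbing file below
`HandleAttachingMaps.lean`, in the style of `…Inversion.lean`, `…Symmetry.lean`,
`…Locality.lean`.  By locality (`HandleAttachingMap.IsMultiAttachment.of_eqOn_near_sphere`,
Kosinski, *Differential Manifolds* (1993), VI §1 and §6: the attached manifold only depends on
the attaching map `h̄ : T → M` near the attaching sphere `S`), an attaching map may be replaced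
by any other one with the same germ at `S`.  This file constructs, for `0 < ε < 1/2`, a
reparametrisation `ρ_ε : T → T` of Kosinski's tube `T = {x ∈ Dᵐ : x_λ ≠ 0}` which is the
identity on `{|x_λ|² > 1 - ε}` and squeezes all of `T` into `{|x_λ|² > 1 - 2ε}`, preserving the
boundary sphere `∂Dᵐ`; precomposing with it gives the **shrunken attaching map**
`h̄ ∘ ρ_ε` (`HandleAttachingMap.shrink`): same germ at `S` (hence the same attachments and the
same attaching sphere), range inside the thin neighbourhood `h̄({|x_λ|² > 1 - 2ε})` of the
attaching sphere.  This is the form of "general position by shrinking the tubular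
neighbourhoods" used before every handle move (room for a birth, bands and slides away from
the other handles).

The reparametrisation is `ρ_ε = α ∘ ψ_ε ∘ α` off `S`, where `α` is Kosinski's inversion
((6.1); it exchanges the vicinity of `S` with the vicinity of the belt disc `{x_λ = 0}`) and
`ψ_ε (x_λ, x_μ) = (m(|x_λ|²) x_λ, c(|x_λ|²) x_μ)` is a *block rescaling with variable
coefficients* squeezing `Dᵐ ∖ S` towards the belt disc: `m² a = σ_ε(a)`,
`c² = (1 - σ_ε(a))/(1 - a)`, with the profile `σ_ε(a) = ε λ₂(a/ε)` (`λ₂` the tree's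
`stretchProfileR 2`, `BallStretch.lean`: `σ_ε = id` on `[0, ε]`, `σ_ε < 2ε`, `σ_ε' > 0`), so
that `ψ_ε` is the identity on `{|x_λ|² ≤ ε}`, preserves `‖x‖ ≤ 1` and `‖x‖ = 1`, and has
`|ψ_ε(x)_λ|² = σ_ε(|x_λ|²) < 2ε`.

## Contents (everything proved; no named facts)

* §1 the profile `HandleShrink.sigma` and its inverse `sigmaInv`, the coefficients `mFun`, `cFun`
  (smooth, `= 1` on `(-∞, ε]`);
* §2 the squeeze `HandleShrink.psi` on vectors and its inverse `psiInv`: `|·_λ|²`, `|·_μ|²`,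
  preservation of the ball and of the sphere, smoothness off `S`;
* §3 `psiBall`, `psiBelt`, `psiInvBelt` on the pieces (smooth for the structures with boundary,
  via the tree's `ContMDiffAt.codRestrict_closedBall`, `contMDiff_coe_closedBall`), and the
  reparametrisation `HandleShrink.rho : OpenPartialHomeomorph T T` (source `univ`, target
  `{|y_λ|² > 1 - σ_ε(1)}`, `C^∞` with `C^∞` inverse, the identity on `{|y_λ|² > 1 - ε}`,
  preserving `‖y‖ = 1`);
* §4 `HandleAttachingMap.shrink h hε hε2 = h̄ ∘ ρ_ε` and its API: `shrink_apply_of_lt` (same germ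
  at `S`), `range_shrink` / `range_shrink_subset` (thin range), `core_shrink`,
  `disjoint_image_range_shrink` (room in `∂M` next to the shrunken handle),
  `isMultiAttachment_shrink_iff` (same attachments, by locality).

## References

* A. A. Kosinski, *Differential Manifolds*, Academic Press (1993), VI §1 (proof of (1.1)), §6,
  (6.1). [Kosinski1993]
-/

open scoped Manifold ContDiff Topology
open Set Function Metric Filter Real

noncomputable section

namespace Literature.Topology.FourManifolds

universe u

/-- Local notation: `𝔼 n` is the model Euclidean space `EuclideanSpace ℝ (Fin n)`. -/
local notation "𝔼 " n:arg => EuclideanSpace ℝ (Fin n)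

/-- Local notation: `𝔻 n` is the closed unit ball in `EuclideanSpace ℝ (Fin n)`. -/
local notation "𝔻 " n:arg => (Metric.closedBall (0 : EuclideanSpace ℝ (Fin n)) 1)

namespace HandleShrink

/-! ### §1 The profile `σ_ε` and the coefficients `m_ε`, `c_ε` -/

section Profile

variable {ε : ℝ}

/-- **The profile `σ_ε(a) = ε λ₂(a/ε)`**: the identity on `(-∞, ε]`, strictly increasing, with
values `< 2ε`. [folklore] -/
def sigma (ε a : ℝ) : ℝ := ε * stretchProfileR 2 (a / ε)

/-- `σ_ε a = a` for `a ≤ ε`. [folklore] -/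
theorem sigma_of_le (hε : 0 < ε) {a : ℝ} (ha : a ≤ ε) : sigma ε a = a := by
  rw [sigma, stretchProfileR_of_le_one one_lt_two ((div_le_one hε).2 ha)]
  field_simp

/-- `σ_ε 0 = 0`. [folklore] -/
theorem sigma_zero (hε : 0 < ε) : sigma ε 0 = 0 := sigma_of_le hε hε.le

/-- `σ_ε a < 2ε`. [folklore] -/
theorem sigma_lt (hε : 0 < ε) (a : ℝ) : sigma ε a < 2 * ε := by
  have := stretchProfileR_lt one_lt_two (a / ε)
  rw [sigma]; nlinarith

/-- `0 < σ_ε a` for `0 < a`. [folklore] -/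
theorem sigma_pos (hε : 0 < ε) {a : ℝ} (ha : 0 < a) : 0 < sigma ε a :=
  mul_pos hε (stretchProfileR_pos one_lt_two (div_pos ha hε))

/-- `0 ≤ σ_ε a` for `0 ≤ a`. [folklore] -/
theorem sigma_nonneg (hε : 0 < ε) {a : ℝ} (ha : 0 ≤ a) : 0 ≤ sigma ε a :=
  mul_nonneg hε.le (stretchProfileR_nonneg one_lt_two (div_nonneg ha hε.le))

/-- `σ_ε` is strictly increasing. [folklore] -/
theorem strictMono_sigma (hε : 0 < ε) : StrictMono (sigma ε) := fun _ _ hab =>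
  mul_lt_mul_of_pos_left (strictMono_stretchProfileR one_lt_two ((div_lt_div_iff_of_pos_right hε).2 hab)) hε

/-- `σ_ε a < 1` when `2ε ≤ 1`. [folklore] -/
theorem sigma_lt_one (hε : 0 < ε) (hε2 : 2 * ε ≤ 1) (a : ℝ) : sigma ε a < 1 :=
  (sigma_lt hε a).trans_le hε2

/-- `σ_ε` is smooth. [folklore] -/
theorem contDiff_sigma (ε : ℝ) : ContDiff ℝ ∞ (sigma ε) :=
  contDiff_const.mul ((contDiff_stretchProfileR one_lt_two).comp (contDiff_id.div_const ε))

/-- The inverse profile `σ_ε⁻¹(s) = ε λ₂⁻¹(s/ε)`. [folklore] -/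
def sigmaInv (ε s : ℝ) : ℝ := ε * stretchProfileRInv 2 (s / ε)

/-- `σ_ε⁻¹ (σ_ε a) = a`. [folklore] -/
theorem sigmaInv_sigma (hε : 0 < ε) (a : ℝ) : sigmaInv ε (sigma ε a) = a := by
  rw [sigmaInv, sigma, mul_div_cancel_left₀ _ hε.ne', stretchProfileRInv_stretchProfileR one_lt_two]
  field_simp

/-- `σ_ε (σ_ε⁻¹ s) = s` for `0 ≤ s < 2ε` (these are values of `σ_ε`). [folklore] -/
theorem sigma_sigmaInv (hε : 0 < ε) {s : ℝ} (hs0 : 0 ≤ s) (hs : s < 2 * ε) :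
    sigma ε (sigmaInv ε s) = s := by
  obtain ⟨t, -, ht⟩ := exists_stretchProfileR_eq one_lt_two (div_nonneg hs0 hε.le)
    ((div_lt_iff₀ hε).2 (by linarith))
  have : s = sigma ε (ε * t) := by
    rw [sigma, mul_div_cancel_left₀ _ hε.ne', ht]; field_simp
  rw [this, sigmaInv_sigma hε]

/-- `σ_ε⁻¹` is smooth at the values of `σ_ε`. [folklore] -/
theorem contDiffAt_sigmaInv (hε : 0 < ε) (a : ℝ) : ContDiffAt ℝ ∞ (sigmaInv ε) (sigma ε a) := by
  have h1 : ContDiffAt ℝ ∞ (stretchProfileRInv 2) (sigma ε a / ε) := by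
    rw [sigma, mul_div_cancel_left₀ _ hε.ne']
    exact contDiffAt_stretchProfileRInv one_lt_two _
  have h2 : ContDiffAt ℝ ∞ (fun s : ℝ => s / ε) (sigma ε a) := contDiffAt_id.div_const ε
  have h3 : ContDiffAt ℝ ∞ (fun s : ℝ => stretchProfileRInv 2 (s / ε)) (sigma ε a) :=
    h1.comp (sigma ε a) h2
  exact contDiffAt_const.mul h3

/-- **The relative excess `g_ε(a) = (σ_ε(a) - a)/a`**, extended by `0` across `a ≤ ε/2` (where
it vanishes identically anyway, `σ_ε = id` on `(-∞, ε]`). [folklore] -/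
def gFun (ε a : ℝ) : ℝ := if a ≤ ε / 2 then 0 else (sigma ε a - a) / a

/-- `g_ε = 0` on `(-∞, ε]`. [folklore] -/
theorem gFun_of_le (hε : 0 < ε) {a : ℝ} (ha : a ≤ ε) : gFun ε a = 0 := by
  unfold gFun
  split_ifs with h
  · rfl
  · rw [sigma_of_le hε ha, sub_self, zero_div]

/-- `g_ε a = (σ_ε a - a)/a` for `ε/2 < a`. [folklore] -/
theorem gFun_of_lt {a : ℝ} (ha : ε / 2 < a) : gFun ε a = (sigma ε a - a) / a := by
  rw [gFun, if_neg (not_le.2 ha)]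

/-- **The key identity `(1 + g_ε a) a = σ_ε a`** (`a > 0`, and trivially at `a = 0`).
[folklore] -/
theorem one_add_gFun_mul (hε : 0 < ε) (a : ℝ) : (1 + gFun ε a) * a = sigma ε a := by
  rcases le_or_gt a (ε / 2) with h | h
  · rw [gFun, if_pos h, add_zero, one_mul, sigma_of_le hε (by linarith)]
  · rw [gFun_of_lt h]
    have ha' : a ≠ 0 := by intro h0; rw [h0] at h; linarith
    field_simp
    ring

/-- `0 < 1 + g_ε a`. [folklore] -/
theorem one_add_gFun_pos (hε : 0 < ε) (a : ℝ) : 0 < 1 + gFun ε a := by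
  rcases le_or_gt a (ε / 2) with h | h
  · rw [gFun, if_pos h]; norm_num
  · have ha : 0 < a := by linarith
    have := one_add_gFun_mul hε a
    have hs := sigma_pos hε ha
    nlinarith

/-- `g_ε` is smooth: near a point `a₀ < ε` it vanishes identically, near a point `a₀ > ε/2`
it is the smooth `(σ_ε a - a)/a`. [folklore] -/
theorem contDiff_gFun (hε : 0 < ε) : ContDiff ℝ ∞ (gFun ε) := by
  rw [contDiff_iff_contDiffAt]
  intro a₀
  rcases lt_or_ge a₀ ε with h | h
  · -- locally zero
    have : gFun ε =ᶠ[𝓝 a₀] fun _ => 0 := by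
      filter_upwards [Iio_mem_nhds h] with a ha
      exact gFun_of_le hε (le_of_lt ha)
    exact (contDiffAt_const.congr_of_eventuallyEq this)
  · -- locally the formula
    have h2 : ε / 2 < a₀ := by linarith
    have : gFun ε =ᶠ[𝓝 a₀] fun a => (sigma ε a - a) / a := by
      filter_upwards [Ioi_mem_nhds h2] with a ha
      exact gFun_of_lt ha
    refine ContDiffAt.congr_of_eventuallyEq ?_ this
    have ha₀ : a₀ ≠ 0 := by intro h0; rw [h0] at h2; linarith
    exact ((contDiff_sigma ε).contDiffAt.sub contDiffAt_id).div contDiffAt_id ha₀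

/-- **The coefficient `m_ε(a) = (1 + g_ε a)^{1/2}`** of `x_λ`: `m_ε² a = σ_ε a`, `m_ε = 1` on
`(-∞, ε]`, smooth and positive. [folklore] -/
def mFun (ε a : ℝ) : ℝ := Real.sqrt (1 + gFun ε a)

/-- `m_ε a = 1` for `a ≤ ε`. [folklore] -/
theorem mFun_of_le (hε : 0 < ε) {a : ℝ} (ha : a ≤ ε) : mFun ε a = 1 := by
  rw [mFun, gFun_of_le hε ha, add_zero, Real.sqrt_one]

/-- `0 < m_ε a`. [folklore] -/
theorem mFun_pos (hε : 0 < ε) (a : ℝ) : 0 < mFun ε a :=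
  Real.sqrt_pos.2 (one_add_gFun_pos hε a)

/-- `m_ε(a)² = 1 + g_ε a`. [folklore] -/
theorem mFun_sq (hε : 0 < ε) (a : ℝ) : mFun ε a ^ 2 = 1 + gFun ε a :=
  Real.sq_sqrt (one_add_gFun_pos hε a).le

/-- `m_ε(a)² a = σ_ε a` (`a ≥ 0`). [folklore] -/
theorem mFun_sq_mul (hε : 0 < ε) (a : ℝ) : mFun ε a ^ 2 * a = sigma ε a := by
  rw [mFun_sq hε, one_add_gFun_mul hε a]

/-- `m_ε` is smooth. [folklore] -/
theorem contDiff_mFun (hε : 0 < ε) : ContDiff ℝ ∞ (mFun ε) :=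
  (contDiff_const.add (contDiff_gFun hε)).sqrt fun a => (one_add_gFun_pos hε a).ne'

/-- **The square `c_ε(a)² = 1 - g_ε(a) a/(1 - a) = (1 - σ_ε a)/(1 - a)`** of the coefficient of
`x_μ` (for `a < 1`). [folklore] -/
def cSq (ε a : ℝ) : ℝ := 1 - gFun ε a * a / (1 - a)

/-- `c_ε² = (1 - σ_ε a)/(1 - a)` for `a < 1`. [folklore] -/
theorem cSq_eq (hε : 0 < ε) {a : ℝ} (ha : a < 1) :
    cSq ε a = (1 - sigma ε a) / (1 - a) := by
  rw [cSq, ← one_add_gFun_mul hε a]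
  have : (1 - a) ≠ 0 := by linarith
  field_simp
  ring

/-- `c_ε² = 1` on `(-∞, ε]`. [folklore] -/
theorem cSq_of_le (hε : 0 < ε) {a : ℝ} (ha : a ≤ ε) : cSq ε a = 1 := by
  rw [cSq, gFun_of_le hε ha, zero_mul, zero_div, sub_zero]

/-- `0 < c_ε²` for `a < 1` (as `σ_ε a < 2ε ≤ 1`). [folklore] -/
theorem cSq_pos (hε : 0 < ε) (hε2 : 2 * ε ≤ 1) {a : ℝ} (ha : a < 1) : 0 < cSq ε a := by
  rw [cSq_eq hε ha]
  exact div_pos (by linarith [sigma_lt_one hε hε2 a]) (by linarith)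

/-- `c_ε²` is smooth at every `a < 1`. [folklore] -/
theorem contDiffAt_cSq (hε : 0 < ε) {a : ℝ} (ha : a < 1) : ContDiffAt ℝ ∞ (cSq ε) a :=
  contDiffAt_const.sub (((contDiff_gFun hε).contDiffAt.mul contDiffAt_id).div
    (contDiffAt_const.sub contDiffAt_id) (by linarith))

/-- **The coefficient `c_ε(a) = (c_ε²)^{1/2}`** of `x_μ`. [folklore] -/
def cFun (ε a : ℝ) : ℝ := Real.sqrt (cSq ε a)

/-- `c_ε a = 1` for `a ≤ ε`. [folklore] -/
theorem cFun_of_le (hε : 0 < ε) {a : ℝ} (ha : a ≤ ε) : cFun ε a = 1 := by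
  rw [cFun, cSq_of_le hε ha, Real.sqrt_one]

/-- `0 < c_ε a` for `a < 1`. [folklore] -/
theorem cFun_pos (hε : 0 < ε) (hε2 : 2 * ε ≤ 1) {a : ℝ} (ha : a < 1) : 0 < cFun ε a :=
  Real.sqrt_pos.2 (cSq_pos hε hε2 ha)

/-- `c_ε(a)² = c_ε²(a)` for `a < 1`. [folklore] -/
theorem cFun_sq (hε : 0 < ε) (hε2 : 2 * ε ≤ 1) {a : ℝ} (ha : a < 1) : cFun ε a ^ 2 = cSq ε a :=
  Real.sq_sqrt (cSq_pos hε hε2 ha).le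

/-- `c_ε` is smooth at every `a < 1`. [folklore] -/
theorem contDiffAt_cFun (hε : 0 < ε) (hε2 : 2 * ε ≤ 1) {a : ℝ} (ha : a < 1) :
    ContDiffAt ℝ ∞ (cFun ε) a :=
  (contDiffAt_cSq hε ha).sqrt (cSq_pos hε hε2 ha).ne'

end Profile

/-! ### §2 The squeeze `ψ_ε` of `Dᵐ ∖ S` towards the belt disc -/

section Squeeze

variable {m : ℕ} {ε : ℝ}

/-- `|x_λ|²` of a block rescaling: `|c x_λ|² = c² |x_λ|²`. [folklore] -/
theorem lamSq_blockScale (k : ℕ) (c d : ℝ) (u : 𝔼 m) :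
    lamSq k (blockScale k c d u) = c ^ 2 * lamSq k u := by
  unfold lamSq
  rw [Finset.mul_sum]
  refine Finset.sum_congr rfl fun i hi => ?_
  rw [Finset.mem_filter] at hi
  rw [blockScale_apply, if_pos hi.2]; ring

/-- `|x_μ|²` of a block rescaling: `|d x_μ|² = d² |x_μ|²`. [folklore] -/
theorem muSq_blockScale (k : ℕ) (c d : ℝ) (u : 𝔼 m) :
    muSq k (blockScale k c d u) = d ^ 2 * muSq k u := by
  unfold muSq
  rw [Finset.mul_sum]
  refine Finset.sum_congr rfl fun i hi => ?_
  rw [Finset.mem_filter] at hi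
  rw [blockScale_apply, if_neg (not_lt.2 hi.2)]; ring

/-- Block rescalings compose by multiplying the coefficients. [folklore] -/
theorem blockScale_blockScale (k : ℕ) (c d c' d' : ℝ) (u : 𝔼 m) :
    blockScale k c d (blockScale k c' d' u) = blockScale k (c * c') (d * d') u := by
  ext i
  simp only [blockScale_apply]
  split_ifs <;> ring

/-- The trivial block rescaling. [folklore] -/
theorem blockScale_one_one (k : ℕ) (u : 𝔼 m) : blockScale k 1 1 u = u := by
  ext i
  simp only [blockScale_apply]
  split_ifs <;> ring

/-- **The squeeze `ψ_ε(x) = (m_ε(|x_λ|²) x_λ, c_ε(|x_λ|²) x_μ)`.** [folklore] -/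
def psi (ε : ℝ) (k : ℕ) (u : 𝔼 m) : 𝔼 m :=
  blockScale k (mFun ε (lamSq k u)) (cFun ε (lamSq k u)) u

/-- `ψ_ε` is the identity on `{|x_λ|² ≤ ε}`. [folklore] -/
theorem psi_eq_self_of_le (hε : 0 < ε) {k : ℕ} {u : 𝔼 m} (hu : lamSq k u ≤ ε) : psi ε k u = u := by
  rw [psi, mFun_of_le hε hu, cFun_of_le hε hu, blockScale_one_one]

/-- `|ψ_ε(x)_λ|² = σ_ε(|x_λ|²)`. [folklore] -/
theorem lamSq_psi (hε : 0 < ε) (k : ℕ) (u : 𝔼 m) : lamSq k (psi ε k u) = sigma ε (lamSq k u) := by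
  rw [psi, lamSq_blockScale, mFun_sq_mul hε (lamSq k u)]

/-- `|ψ_ε(x)_μ|² = c_ε² |x_μ|²` (for `|x_λ|² < 1`). [folklore] -/
theorem muSq_psi (hε : 0 < ε) (hε2 : 2 * ε ≤ 1) {k : ℕ} {u : 𝔼 m} (hu : lamSq k u < 1) :
    muSq k (psi ε k u) = cSq ε (lamSq k u) * muSq k u := by
  rw [psi, muSq_blockScale, cFun_sq hε hε2 hu]

/-- **`ψ_ε` preserves the closed ball**: `‖ψ_ε x‖² = σ + (1 - σ)/(1 - a) |x_μ|² ≤ 1` for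
`‖x‖ ≤ 1`, `a = |x_λ|² < 1`, since `|x_μ|² ≤ 1 - a`. [folklore] -/
theorem norm_psi_sq (hε : 0 < ε) (hε2 : 2 * ε ≤ 1) {k : ℕ} {u : 𝔼 m} (hu : lamSq k u < 1) :
    ‖psi ε k u‖ ^ 2 = sigma ε (lamSq k u) +
      (1 - sigma ε (lamSq k u)) / (1 - lamSq k u) * muSq k u := by
  rw [← lamSq_add_muSq k, lamSq_psi hε, muSq_psi hε hε2 hu, cSq_eq hε hu]

/-- `‖ψ_ε x‖ ≤ 1` for `‖x‖ ≤ 1`, `|x_λ|² < 1`. [folklore] -/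
theorem norm_psi_le_one (hε : 0 < ε) (hε2 : 2 * ε ≤ 1) {k : ℕ} {u : 𝔼 m} (hu1 : ‖u‖ ≤ 1)
    (hu : lamSq k u < 1) : ‖psi ε k u‖ ≤ 1 := by
  have hsq := norm_psi_sq hε hε2 hu
  have hsum := lamSq_add_muSq k u
  have hu1' : ‖u‖ ^ 2 ≤ 1 := by nlinarith [norm_nonneg u]
  have hμ : muSq k u ≤ 1 - lamSq k u := by linarith
  have hσ := sigma_lt_one hε hε2 (lamSq k u)
  have hq : 0 < (1 - sigma ε (lamSq k u)) / (1 - lamSq k u) := div_pos (by linarith) (by linarith)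
  have hne : 1 - lamSq k u ≠ 0 := (sub_pos.2 hu).ne'
  have hle : (1 - sigma ε (lamSq k u)) / (1 - lamSq k u) * muSq k u ≤ 1 - sigma ε (lamSq k u) := by
    calc (1 - sigma ε (lamSq k u)) / (1 - lamSq k u) * muSq k u
        ≤ (1 - sigma ε (lamSq k u)) / (1 - lamSq k u) * (1 - lamSq k u) :=
          mul_le_mul_of_nonneg_left hμ hq.le
      _ = 1 - sigma ε (lamSq k u) := by field_simp
  have h2 : ‖psi ε k u‖ ^ 2 ≤ 1 := by linarith
  nlinarith [norm_nonneg (psi ε k u)]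

/-- `‖ψ_ε x‖ = 1 ↔ ‖x‖ = 1` (for `‖x‖ ≤ 1`, `|x_λ|² < 1`). [folklore] -/
theorem norm_psi_eq_one_iff (hε : 0 < ε) (hε2 : 2 * ε ≤ 1) {k : ℕ} {u : 𝔼 m} (hu1 : ‖u‖ ≤ 1)
    (hu : lamSq k u < 1) : ‖psi ε k u‖ = 1 ↔ ‖u‖ = 1 := by
  have hsq := norm_psi_sq hε hε2 hu
  have hsum := lamSq_add_muSq k u
  have hσ := sigma_lt_one hε hε2 (lamSq k u)
  set q := (1 - sigma ε (lamSq k u)) / (1 - lamSq k u) with hq_def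
  have hq : 0 < q := div_pos (by linarith) (by linarith)
  have hne : 1 - lamSq k u ≠ 0 := (sub_pos.2 hu).ne'
  have hq1 : q * (1 - lamSq k u) = 1 - sigma ε (lamSq k u) := by rw [hq_def]; field_simp
  have key : ‖psi ε k u‖ ^ 2 = 1 ↔ ‖u‖ ^ 2 = 1 := by
    rw [hsq, ← hsum]
    constructor
    · intro h
      have : q * muSq k u = q * (1 - lamSq k u) := by linarith
      have := mul_left_cancel₀ hq.ne' this
      linarith
    · intro h
      have hμ : muSq k u = 1 - lamSq k u := by linarith
      rw [hμ, hq1]; ring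
  constructor
  · intro h
    have := key.1 (by rw [h, one_pow])
    nlinarith [norm_nonneg u]
  · intro h
    have := key.2 (by rw [h, one_pow])
    nlinarith [norm_nonneg (psi ε k u)]

/-- **`ψ_ε` is smooth at every point with `|x_λ|² < 1`** (its coordinates are the coordinates
of `x` times smooth functions of `|x_λ|²`). [folklore] -/
theorem contDiffAt_psi (hε : 0 < ε) (hε2 : 2 * ε ≤ 1) {k : ℕ} {u : 𝔼 m} (hu : lamSq k u < 1) :
    ContDiffAt ℝ ∞ (psi ε k (m := m)) u := by
  have hl : ContDiffAt ℝ ∞ (lamSq (m := m) k) u := (contDiff_lamSq k).contDiffAt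
  have hM : ContDiffAt ℝ ∞ (fun v : 𝔼 m => mFun ε (lamSq k v)) u :=
    (contDiff_mFun hε).contDiffAt.comp (f := lamSq (m := m) k) u hl
  have hC : ContDiffAt ℝ ∞ (fun v : 𝔼 m => cFun ε (lamSq k v)) u :=
    (contDiffAt_cFun hε hε2 hu).comp (f := lamSq (m := m) k) u hl
  rw [contDiffAt_euclidean]
  intro i
  have hc : ContDiffAt ℝ ∞ (fun v : 𝔼 m => v i) u :=
    (contDiff_piLp_apply (p := 2) (E := fun _ : Fin m => ℝ) (𝕜 := ℝ) (n := ∞) (i := i)).contDiffAt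
  by_cases hi : (i : ℕ) < k
  · have : (fun v : 𝔼 m => psi ε k v i) = fun v => mFun ε (lamSq k v) * v i := by
      funext v; rw [psi, blockScale_apply, if_pos hi]
    rw [this]
    exact hM.mul hc
  · have : (fun v : 𝔼 m => psi ε k v i) = fun v => cFun ε (lamSq k v) * v i := by
      funext v; rw [psi, blockScale_apply, if_neg hi]
    rw [this]
    exact hC.mul hc

/-- **The inverse squeeze** `ψ_ε⁻¹(y) = (x_λ/m_ε(a), x_μ/c_ε(a))`, `a = σ_ε⁻¹(|y_λ|²)`.
[folklore] -/
def psiInv (ε : ℝ) (k : ℕ) (v : 𝔼 m) : 𝔼 m :=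
  blockScale k (mFun ε (sigmaInv ε (lamSq k v)))⁻¹ (cFun ε (sigmaInv ε (lamSq k v)))⁻¹ v

/-- `ψ_ε⁻¹ (ψ_ε x) = x` for `|x_λ|² < 1`. [folklore] -/
theorem psiInv_psi (hε : 0 < ε) (hε2 : 2 * ε ≤ 1) {k : ℕ} {u : 𝔼 m} (hu : lamSq k u < 1) :
    psiInv ε k (psi ε k u) = u := by
  rw [psiInv, lamSq_psi hε, sigmaInv_sigma hε, psi, blockScale_blockScale,
    inv_mul_cancel₀ (mFun_pos hε _).ne', inv_mul_cancel₀ (cFun_pos hε hε2 hu).ne',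
    blockScale_one_one]

/-- `|ψ_ε⁻¹(y)_λ|² = σ_ε⁻¹(|y_λ|²)` for `0 ≤ |y_λ|² < 2ε`. [folklore] -/
theorem lamSq_psiInv (hε : 0 < ε) {k : ℕ} {v : 𝔼 m} (hv : lamSq k v < 2 * ε) :
    lamSq k (psiInv ε k v) = sigmaInv ε (lamSq k v) := by
  set a := sigmaInv ε (lamSq k v) with ha
  have hσa : sigma ε a = lamSq k v := sigma_sigmaInv hε (lamSq_nonneg k v) hv
  have ha0 : 0 ≤ a := by
    by_contra h
    have := strictMono_sigma hε (not_le.1 h)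
    rw [hσa, sigma_zero hε] at this
    exact absurd this (not_lt.2 (lamSq_nonneg k v))
  have hm := mFun_sq_mul hε a
  rw [psiInv, lamSq_blockScale, ← ha, inv_pow, ← hσa, ← hm]
  have := (mFun_pos hε a).ne'
  field_simp

/-- `0 ≤ σ_ε⁻¹(b)` for `0 ≤ b < 2ε` (`σ_ε` is increasing with `σ_ε 0 = 0`). [folklore] -/
theorem sigmaInv_nonneg (hε : 0 < ε) {b : ℝ} (hb0 : 0 ≤ b) (hb : b < 2 * ε) :
    0 ≤ sigmaInv ε b := by
  by_contra h
  have := strictMono_sigma hε (not_le.1 h)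
  rw [sigma_sigmaInv hε hb0 hb, sigma_zero hε] at this
  exact absurd this (not_lt.2 hb0)

/-- `ψ_ε (ψ_ε⁻¹ y) = y` for `0 ≤ |y_λ|² < 2ε` with `σ_ε⁻¹(|y_λ|²) < 1`. [folklore] -/
theorem psi_psiInv (hε : 0 < ε) (hε2 : 2 * ε ≤ 1) {k : ℕ} {v : 𝔼 m} (hv : lamSq k v < 2 * ε)
    (hv1 : sigmaInv ε (lamSq k v) < 1) : psi ε k (psiInv ε k v) = v := by
  have ha0 := sigmaInv_nonneg hε (lamSq_nonneg k v) hv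
  rw [psi, lamSq_psiInv hε hv, psiInv, blockScale_blockScale,
    mul_inv_cancel₀ (mFun_pos hε _).ne', mul_inv_cancel₀ (cFun_pos hε hε2 hv1).ne',
    blockScale_one_one]

/-- `ψ_ε⁻¹` is smooth at every point `y` with `|y_λ|² < 2ε` and `σ_ε⁻¹(|y_λ|²) < 1`. [folklore] -/
theorem contDiffAt_psiInv (hε : 0 < ε) (hε2 : 2 * ε ≤ 1) {k : ℕ} {v : 𝔼 m} (hv : lamSq k v < 2 * ε)
    (hv1 : sigmaInv ε (lamSq k v) < 1) : ContDiffAt ℝ ∞ (psiInv ε k (m := m)) v := by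
  have ha0 := sigmaInv_nonneg hε (lamSq_nonneg k v) hv
  have hl : ContDiffAt ℝ ∞ (lamSq (m := m) k) v := (contDiff_lamSq k).contDiffAt
  have hS : ContDiffAt ℝ ∞ (fun w : 𝔼 m => sigmaInv ε (lamSq k w)) v := by
    have h1 : ContDiffAt ℝ ∞ (sigmaInv ε) (lamSq k v) := by
      have := contDiffAt_sigmaInv hε (sigmaInv ε (lamSq k v))
      rwa [sigma_sigmaInv hε (lamSq_nonneg k v) hv] at this
    exact h1.comp v hl
  have hM' : ContDiffAt ℝ ∞ (fun w : 𝔼 m => mFun ε (sigmaInv ε (lamSq k w))) v :=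
    (contDiff_mFun hε).contDiffAt.comp (f := fun w : 𝔼 m => sigmaInv ε (lamSq k w)) v hS
  have hM : ContDiffAt ℝ ∞ (fun w : 𝔼 m => (mFun ε (sigmaInv ε (lamSq k w)))⁻¹) v :=
    hM'.inv (mFun_pos hε _).ne'
  have hC' : ContDiffAt ℝ ∞ (fun w : 𝔼 m => cFun ε (sigmaInv ε (lamSq k w))) v :=
    (contDiffAt_cFun hε hε2 hv1).comp (f := fun w : 𝔼 m => sigmaInv ε (lamSq k w)) v hS
  have hC : ContDiffAt ℝ ∞ (fun w : 𝔼 m => (cFun ε (sigmaInv ε (lamSq k w)))⁻¹) v :=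
    hC'.inv (cFun_pos hε hε2 hv1).ne'
  rw [contDiffAt_euclidean]
  intro i
  have hc : ContDiffAt ℝ ∞ (fun w : 𝔼 m => w i) v :=
    (contDiff_piLp_apply (p := 2) (E := fun _ : Fin m => ℝ) (𝕜 := ℝ) (n := ∞) (i := i)).contDiffAt
  by_cases hi : (i : ℕ) < k
  · have : (fun w : 𝔼 m => psiInv ε k w i) =
        fun w => (mFun ε (sigmaInv ε (lamSq k w)))⁻¹ * w i := by
      funext w; rw [psiInv, blockScale_apply, if_pos hi]
    rw [this]
    exact hM.mul hc
  · have : (fun w : 𝔼 m => psiInv ε k w i) =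
        fun w => (cFun ε (sigmaInv ε (lamSq k w)))⁻¹ * w i := by
      funext w; rw [psiInv, blockScale_apply, if_neg hi]
    rw [this]
    exact hC.mul hc

/-- `σ_ε⁻¹ = id` on `(-∞, ε]`. [folklore] -/
theorem sigmaInv_of_le (hε : 0 < ε) {s : ℝ} (hs : s ≤ ε) : sigmaInv ε s = s := by
  rw [sigmaInv, stretchProfileRInv_of_le_one one_lt_two ((div_le_one hε).2 hs)]
  field_simp

/-- `ψ_ε⁻¹` is the identity on `{|y_λ|² ≤ ε}`. [folklore] -/
theorem psiInv_eq_self_of_le (hε : 0 < ε) {k : ℕ} {v : 𝔼 m} (hv : lamSq k v ≤ ε) :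
    psiInv ε k v = v := by
  rw [psiInv, sigmaInv_of_le hε hv, mFun_of_le hε hv, cFun_of_le hε hv, inv_one,
    blockScale_one_one]

/-- `|ψ_ε⁻¹(y)_μ|² = |y_μ|²/c_ε²(a)`, `a = σ_ε⁻¹(|y_λ|²)`. [folklore] -/
theorem muSq_psiInv (hε : 0 < ε) (hε2 : 2 * ε ≤ 1) {k : ℕ} {v : 𝔼 m} (hv : lamSq k v < 2 * ε)
    (hv1 : sigmaInv ε (lamSq k v) < 1) :
    muSq k (psiInv ε k v) = muSq k v / cSq ε (sigmaInv ε (lamSq k v)) := by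
  have ha0 := sigmaInv_nonneg hε (lamSq_nonneg k v) hv
  rw [psiInv, muSq_blockScale, inv_pow, cFun_sq hε hε2 hv1]
  ring

/-- **`ψ_ε⁻¹` preserves the closed ball** on its domain of interest: for `‖y‖ ≤ 1`,
`|y_λ|² < 2ε` and `a = σ_ε⁻¹(|y_λ|²) < 1`, `‖ψ_ε⁻¹ y‖² = a + |y_μ|² (1 - a)/(1 - σ_ε a) ≤ 1`.
[folklore] -/
theorem norm_psiInv_le_one (hε : 0 < ε) (hε2 : 2 * ε ≤ 1) {k : ℕ} {v : 𝔼 m} (hv1' : ‖v‖ ≤ 1)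
    (hv : lamSq k v < 2 * ε) (hv1 : sigmaInv ε (lamSq k v) < 1) : ‖psiInv ε k v‖ ≤ 1 := by
  set a := sigmaInv ε (lamSq k v) with ha
  have ha0 : 0 ≤ a := sigmaInv_nonneg hε (lamSq_nonneg k v) hv
  have hσa : sigma ε a = lamSq k v := sigma_sigmaInv hε (lamSq_nonneg k v) hv
  have hsum := lamSq_add_muSq k v
  have hv2 : ‖v‖ ^ 2 ≤ 1 := by nlinarith [norm_nonneg v]
  have hμ : muSq k v ≤ 1 - sigma ε a := by linarith
  have hσ1 : sigma ε a < 1 := sigma_lt_one hε hε2 a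
  have hq : cSq ε a = (1 - sigma ε a) / (1 - a) := cSq_eq hε hv1
  have hqpos : 0 < cSq ε a := cSq_pos hε hε2 hv1
  have h1 : ‖psiInv ε k v‖ ^ 2 = a + muSq k v / cSq ε a := by
    rw [← lamSq_add_muSq k, lamSq_psiInv hε hv, muSq_psiInv hε hε2 hv hv1]
  have h2 : muSq k v / cSq ε a ≤ 1 - a := by
    rw [div_le_iff₀ hqpos, hq]
    have hne : 1 - a ≠ 0 := (sub_pos.2 hv1).ne'
    have : (1 - a) * ((1 - sigma ε a) / (1 - a)) = 1 - sigma ε a := by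
      field_simp
    nlinarith
  have h3 : ‖psiInv ε k v‖ ^ 2 ≤ 1 := by linarith
  nlinarith [norm_nonneg (psiInv ε k v)]

end Squeeze

/-! ### §3 `ψ_ε` on the pieces and the reparametrisation `ρ_ε = α ψ_ε α` of the tube `T` -/

section Pieces

variable (n k : ℕ) {ε : ℝ} (hε : 0 < ε) (hε2 : 2 * ε ≤ 1)

include hε hε2

/-- `ψ_ε` maps the closed ball into itself. [folklore] -/
theorem psi_coe_mem_closedBall (u : 𝔻 (n + 1)) : psi ε k (u : 𝔼 (n + 1)) ∈ 𝔻 (n + 1) := by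
  have hu1 : ‖(u : 𝔼 (n + 1))‖ ≤ 1 := mem_closedBall_zero_iff.1 u.2
  rcases lt_or_eq_of_le (lamSq_le_one (k := k) hu1) with hlt | heq
  · exact mem_closedBall_zero_iff.2 (norm_psi_le_one hε hε2 hu1 hlt)
  · -- on the attaching sphere `x_μ = 0`, so `ψ x = m x_λ` has norm² `σ(1) < 1`
    have hμ : muSq k (u : 𝔼 (n + 1)) = 0 := (muSq_eq_zero_of_lamSq_eq_one hu1 heq).1
    have h1 : ‖psi ε k (u : 𝔼 (n + 1))‖ ^ 2 = sigma ε 1 := by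
      rw [← lamSq_add_muSq k, lamSq_psi hε, psi, muSq_blockScale, hμ, heq]; ring
    have h2 := sigma_lt_one hε hε2 1
    apply mem_closedBall_zero_iff.2
    nlinarith [norm_nonneg (psi ε k (u : 𝔼 (n + 1)))]

/-- **`ψ_ε` as a self-map of the closed ball.** [folklore] -/
def psiBall : 𝔻 (n + 1) → 𝔻 (n + 1) :=
  Set.codRestrict (fun u : 𝔻 (n + 1) => psi ε k (u : 𝔼 (n + 1))) (𝔻 (n + 1))
    (psi_coe_mem_closedBall n k hε hε2)

/-- The underlying vector of `psiBall`. [folklore] -/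
@[simp] theorem coe_psiBall (u : 𝔻 (n + 1)) :
    (psiBall n k hε hε2 u : 𝔼 (n + 1)) = psi ε k (u : 𝔼 (n + 1)) := rfl

/-- `ψ_ε : Dᵐ → Dᵐ` is `C^∞` at every point with `|x_λ|² < 1`. [folklore] -/
theorem contMDiffAt_psiBall {u : 𝔻 (n + 1)} (hu : lamSq k (u : 𝔼 (n + 1)) < 1) :
    ContMDiffAt (𝓡∂ (n + 1)) (𝓡∂ (n + 1)) ∞ (psiBall n k hε hε2) u := by
  have h : ContMDiffAt (𝓡∂ (n + 1)) 𝓘(ℝ, 𝔼 (n + 1)) ∞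
      (fun v : 𝔻 (n + 1) => psi ε k (v : 𝔼 (n + 1))) u :=
    (contDiffAt_psi hε hε2 hu).contMDiffAt.comp u (contMDiff_coe_closedBall u)
  exact h.codRestrict_closedBall _

/-- **`ψ_ε` on the piece `Dᵐ ∖ S`** (it maps it into `{|x_λ|² < 2ε} ⊆ Dᵐ ∖ S`). [folklore] -/
def psiBelt (b : ↥(beltPiece n k)) : ↥(beltPiece n k) :=
  ⟨psiBall n k hε hε2 b, by
    rw [mem_beltPiece, coe_psiBall, lamSq_psi hε]
    exact (sigma_lt_one hε hε2 _).ne⟩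

/-- The underlying vector of `psiBelt b`. [folklore] -/
@[simp] theorem coe_coe_psiBelt (b : ↥(beltPiece n k)) :
    (((psiBelt n k hε hε2 b : ↥(beltPiece n k)) : 𝔻 (n + 1)) : 𝔼 (n + 1)) =
      psi ε k (((b : 𝔻 (n + 1)) : 𝔼 (n + 1))) := rfl

omit hε hε2 in
/-- `|x_λ|² < 1` on `Dᵐ ∖ S`. [folklore] -/
theorem lamSq_lt_one_beltPiece (b : ↥(beltPiece n k)) :
    lamSq k (((b : 𝔻 (n + 1)) : 𝔼 (n + 1))) < 1 :=
  lt_of_le_of_ne (lamSq_le_one (mem_closedBall_zero_iff.1 (b : 𝔻 (n + 1)).2)) b.2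

/-- **`ψ_ε : Dᵐ ∖ S → Dᵐ ∖ S` is `C^∞`.** [folklore] -/
theorem contMDiff_psiBelt : ContMDiff (𝓡∂ (n + 1)) (𝓡∂ (n + 1)) ∞ (psiBelt n k hε hε2) := by
  intro b
  rw [← ContMDiffAt.subtypeVal_comp_iff]
  exact (contMDiffAt_psiBall n k hε hε2 (lamSq_lt_one_beltPiece n k b)).comp b
    (contMDiff_subtype_val b)

/-- `ψ_ε⁻¹` maps a point `y ∈ Dᵐ` with `|y_λ|² < σ_ε(1)` into `Dᵐ`. [folklore] -/
theorem psiInv_coe_mem_closedBall {v : 𝔻 (n + 1)}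
    (hv : lamSq k (v : 𝔼 (n + 1)) < sigma ε 1) : psiInv ε k (v : 𝔼 (n + 1)) ∈ 𝔻 (n + 1) := by
  have hv2 : lamSq k (v : 𝔼 (n + 1)) < 2 * ε := hv.trans (sigma_lt hε 1)
  have hv1 : sigmaInv ε (lamSq k (v : 𝔼 (n + 1))) < 1 := by
    by_contra h
    have := (strictMono_sigma hε).monotone (not_lt.1 h)
    rw [sigma_sigmaInv hε (lamSq_nonneg k _) hv2] at this
    exact absurd this (not_le.2 hv)
  exact mem_closedBall_zero_iff.2
    (norm_psiInv_le_one hε hε2 (mem_closedBall_zero_iff.1 v.2) hv2 hv1)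

omit hε2 in
/-- `σ_ε⁻¹(|y_λ|²) < 1` when `|y_λ|² < σ_ε(1)`. [folklore] -/
theorem sigmaInv_lt_one {b : ℝ} (hb : b < sigma ε 1) (hb0 : 0 ≤ b) : sigmaInv ε b < 1 := by
  have hb2 : b < 2 * ε := hb.trans (sigma_lt hε 1)
  by_contra h
  have := (strictMono_sigma hε).monotone (not_lt.1 h)
  rw [sigma_sigmaInv hε hb0 hb2] at this
  exact absurd this (not_le.2 hb)

variable [Nonempty ↥(handleTube n k)]

/-- **`ψ_ε⁻¹` on the piece `Dᵐ ∖ S`**, genuinely on `{|y_λ|² < σ_ε(1)}` (junk value `b`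
elsewhere). [folklore] -/
def psiInvBelt (b : ↥(beltPiece n k)) : ↥(beltPiece n k) :=
  if hb : lamSq k (((b : 𝔻 (n + 1)) : 𝔼 (n + 1))) < sigma ε 1 then
    ⟨⟨psiInv ε k (((b : 𝔻 (n + 1)) : 𝔼 (n + 1))), psiInv_coe_mem_closedBall n k hε hε2 hb⟩, by
      rw [mem_beltPiece]
      show lamSq k (psiInv ε k (((b : 𝔻 (n + 1)) : 𝔼 (n + 1)))) ≠ 1
      rw [lamSq_psiInv hε (hb.trans (sigma_lt hε 1))]
      exact (sigmaInv_lt_one hε hb (lamSq_nonneg k _)).ne⟩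
  else b

omit [Nonempty ↥(handleTube n k)] in
/-- The underlying vector of `psiInvBelt b` on `{|y_λ|² < σ_ε(1)}`. [folklore] -/
theorem coe_coe_psiInvBelt {b : ↥(beltPiece n k)}
    (hb : lamSq k (((b : 𝔻 (n + 1)) : 𝔼 (n + 1))) < sigma ε 1) :
    (((psiInvBelt n k hε hε2 b : ↥(beltPiece n k)) : 𝔻 (n + 1)) : 𝔼 (n + 1)) =
      psiInv ε k (((b : 𝔻 (n + 1)) : 𝔼 (n + 1))) := by
  rw [psiInvBelt, dif_pos hb]

omit [Nonempty ↥(handleTube n k)] in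
/-- **`ψ_ε⁻¹ : Dᵐ ∖ S ⇀ Dᵐ ∖ S` is `C^∞` on `{|y_λ|² < σ_ε(1)}`.** [folklore] -/
theorem contMDiffOn_psiInvBelt :
    ContMDiffOn (𝓡∂ (n + 1)) (𝓡∂ (n + 1)) ∞ (psiInvBelt n k hε hε2)
      {b | lamSq k (((b : 𝔻 (n + 1)) : 𝔼 (n + 1))) < sigma ε 1} := by
  intro b hb
  have hb' : lamSq k (((b : 𝔻 (n + 1)) : 𝔼 (n + 1))) < sigma ε 1 := hb
  have hopen : IsOpen {b : ↥(beltPiece n k) | lamSq k (((b : 𝔻 (n + 1)) : 𝔼 (n + 1))) < sigma ε 1} :=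
    isOpen_lt (continuous_lamSq_beltPiece n k) continuous_const
  refine ContMDiffAt.contMDiffWithinAt ?_
  rw [← ContMDiffAt.subtypeVal_comp_iff]
  -- the honest formula near `b`
  have hv2 : lamSq k (((b : 𝔻 (n + 1)) : 𝔼 (n + 1))) < 2 * ε := hb'.trans (sigma_lt hε 1)
  have hv1 := sigmaInv_lt_one hε hb' (lamSq_nonneg k _)
  have hG : ContMDiffAt (𝓡∂ (n + 1)) 𝓘(ℝ, 𝔼 (n + 1)) ∞
      (fun b' : ↥(beltPiece n k) => psiInv ε k (((b' : 𝔻 (n + 1)) : 𝔼 (n + 1)))) b :=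
    (contDiffAt_psiInv hε hε2 hv2 hv1).contMDiffAt.comp
      (f := fun b' : ↥(beltPiece n k) => ((b' : 𝔻 (n + 1)) : 𝔼 (n + 1))) b
      ((contMDiff_coe_closedBall _).comp b (contMDiff_subtype_val b))
  -- a total smooth map into `𝔻` agreeing with `val ∘ psiInvBelt` near `b`
  have hmem : ∀ b' : ↥(beltPiece n k), (fun b'' : ↥(beltPiece n k) =>
      if lamSq k (((b'' : 𝔻 (n + 1)) : 𝔼 (n + 1))) < sigma ε 1 then
        psiInv ε k (((b'' : 𝔻 (n + 1)) : 𝔼 (n + 1))) else (((b'' : 𝔻 (n + 1)) : 𝔼 (n + 1)))) b' ∈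
      𝔻 (n + 1) := fun b' => by
    dsimp only
    split_ifs with h
    · exact psiInv_coe_mem_closedBall n k hε hε2 h
    · exact (b' : 𝔻 (n + 1)).2
  have hG' : ContMDiffAt (𝓡∂ (n + 1)) 𝓘(ℝ, 𝔼 (n + 1)) ∞
      (fun b'' : ↥(beltPiece n k) =>
        if lamSq k (((b'' : 𝔻 (n + 1)) : 𝔼 (n + 1))) < sigma ε 1 then
          psiInv ε k (((b'' : 𝔻 (n + 1)) : 𝔼 (n + 1))) else (((b'' : 𝔻 (n + 1)) : 𝔼 (n + 1)))) b := by
    refine hG.congr_of_eventuallyEq ?_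
    filter_upwards [hopen.mem_nhds hb] with b'' hb''
    have : lamSq k (((b'' : 𝔻 (n + 1)) : 𝔼 (n + 1))) < sigma ε 1 := hb''
    rw [if_pos this]
  have hcod := hG'.codRestrict_closedBall hmem
  refine hcod.congr_of_eventuallyEq ?_
  filter_upwards [hopen.mem_nhds hb] with b'' hb''
  have : lamSq k (((b'' : 𝔻 (n + 1)) : 𝔼 (n + 1))) < sigma ε 1 := hb''
  apply Subtype.ext
  simp only [comp_apply, Set.val_codRestrict_apply, if_pos this]
  exact coe_coe_psiInvBelt n k hε hε2 this

/-! #### The reparametrisation `ρ_ε` of `T` -/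

/-- Abbreviation for this section: Kosinski's `α : Dᵐ ∖ S ⇀ T`. [folklore] -/
local notation "A" => handleInversionPH n k

omit hε hε2 [Nonempty ↥(handleTube n k)] in
/-- `|y_λ|² ≤ 1` on `T`. [folklore] -/
theorem lamSq_le_one_handleTube (y : ↥(handleTube n k)) :
    lamSq k (((y : 𝔻 (n + 1)) : 𝔼 (n + 1))) ≤ 1 :=
  lamSq_le_one (mem_closedBall_zero_iff.1 (y : 𝔻 (n + 1)).2)

omit hε hε2 [Nonempty ↥(handleTube n k)] in
/-- `0 < |y_λ|²` on `T`. [folklore] -/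
theorem lamSq_pos_handleTube (y : ↥(handleTube n k)) :
    0 < lamSq k (((y : 𝔻 (n + 1)) : 𝔼 (n + 1))) :=
  lt_of_le_of_ne (lamSq_nonneg k _) (Ne.symm y.2)

omit hε2 [Nonempty ↥(handleTube n k)] in
/-- `ε < σ_ε(1)` (as `λ₂` is strictly increasing with `λ₂ 1 = 1` and `1 < 1/ε`), for `ε < 1`.
[folklore] -/
theorem lt_sigma_one (hε1 : ε < 1) : ε < sigma ε 1 := by
  have h1 : (1 : ℝ) < 1 / ε := by rw [lt_div_iff₀ hε]; linarith
  have := strictMono_stretchProfileR one_lt_two h1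
  rw [stretchProfileR_of_le_one one_lt_two le_rfl] at this
  rw [sigma]
  nlinarith

omit hε2 [Nonempty ↥(handleTube n k)] in
/-- `0 < σ_ε⁻¹ b` for `0 < b < 2ε`. [folklore] -/
theorem sigmaInv_pos {b : ℝ} (hb0 : 0 < b) (hb : b < 2 * ε) : 0 < sigmaInv ε b := by
  by_contra h
  have := (strictMono_sigma hε).monotone (not_lt.1 h)
  rw [sigma_sigmaInv hε hb0.le hb, sigma_zero hε] at this
  exact absurd this (not_le.2 hb0)

/-- **The forward reparametrisation `ρ_ε`** on points: the identity on the attaching sphere,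
`α ψ_ε α` off it. [folklore] -/
def rhoFun (y : ↥(handleTube n k)) : ↥(handleTube n k) :=
  if lamSq k (((y : 𝔻 (n + 1)) : 𝔼 (n + 1))) = 1 then y else A (psiBelt n k hε hε2 ((A).symm y))

/-- **The backward reparametrisation `ρ_ε⁻¹`** on points: the identity on the attaching
sphere, `α ψ_ε⁻¹ α` off it. [folklore] -/
def rhoInv (y : ↥(handleTube n k)) : ↥(handleTube n k) :=
  if lamSq k (((y : 𝔻 (n + 1)) : 𝔼 (n + 1))) = 1 then y
  else A (psiInvBelt n k hε hε2 ((A).symm y))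

/-- `ρ_ε = id` on the attaching sphere. [folklore] -/
theorem rhoFun_of_eq_one {y : ↥(handleTube n k)} (hy : lamSq k (((y : 𝔻 (n + 1)) : 𝔼 (n + 1))) = 1) :
    rhoFun n k hε hε2 y = y := by
  rw [rhoFun, if_pos hy]

/-- `ρ_ε⁻¹ = id` on the attaching sphere. [folklore] -/
theorem rhoInv_of_eq_one {y : ↥(handleTube n k)} (hy : lamSq k (((y : 𝔻 (n + 1)) : 𝔼 (n + 1))) = 1) :
    rhoInv n k hε hε2 y = y := by
  rw [rhoInv, if_pos hy]

omit hε hε2 in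
/-- `|α(y)_λ|² = 1 - |y_λ|²` on `T`. [folklore] -/
theorem lamSq_symm_apply (y : ↥(handleTube n k)) :
    lamSq k ((((A).symm y : ↥(beltPiece n k)) : 𝔻 (n + 1)) : 𝔼 (n + 1)) =
      1 - lamSq k (((y : 𝔻 (n + 1)) : 𝔼 (n + 1))) := by
  rw [coe_coe_handleInversionPH_symm,
    lamSq_handleInversion (lamSq_pos_handleTube n k y) (lamSq_le_one_handleTube n k y)]

/-- The squeezed inverted point `ψ_ε (α y)` has `|·_λ|² = σ_ε(1 - |y_λ|²)`, which is positive
off the attaching sphere. [folklore] -/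
theorem lamSq_psiBelt_symm (y : ↥(handleTube n k)) :
    lamSq k ((((psiBelt n k hε hε2 ((A).symm y)) : ↥(beltPiece n k)) : 𝔻 (n + 1)) : 𝔼 (n + 1)) =
      sigma ε (1 - lamSq k (((y : 𝔻 (n + 1)) : 𝔼 (n + 1)))) := by
  rw [coe_coe_psiBelt, lamSq_psi hε, lamSq_symm_apply]

/-- **`ρ_ε` off the attaching sphere, on vectors**: `ρ_ε y = α (ψ_ε (α y))`. [folklore] -/
theorem coe_coe_rhoFun_of_ne {y : ↥(handleTube n k)}
    (hy : lamSq k (((y : 𝔻 (n + 1)) : 𝔼 (n + 1))) ≠ 1) :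
    (((rhoFun n k hε hε2 y : ↥(handleTube n k)) : 𝔻 (n + 1)) : 𝔼 (n + 1)) =
      handleInversion k (psi ε k (handleInversion k (((y : 𝔻 (n + 1)) : 𝔼 (n + 1))))) := by
  have ha : lamSq k (((y : 𝔻 (n + 1)) : 𝔼 (n + 1))) < 1 :=
    lt_of_le_of_ne (lamSq_le_one_handleTube n k y) hy
  have hpos : lamSq k ((((psiBelt n k hε hε2 ((A).symm y)) : ↥(beltPiece n k)) : 𝔻 (n + 1)) :
      𝔼 (n + 1)) ≠ 0 := by
    rw [lamSq_psiBelt_symm]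
    exact (sigma_pos hε (by linarith)).ne'
  rw [rhoFun, if_neg hy, coe_coe_handleInversionPH n k hpos, coe_coe_psiBelt,
    coe_coe_handleInversionPH_symm]

/-- `|ρ_ε(y)_λ|² = 1 - σ_ε(1 - |y_λ|²)` off the attaching sphere. [folklore] -/
theorem lamSq_rhoFun_of_ne {y : ↥(handleTube n k)}
    (hy : lamSq k (((y : 𝔻 (n + 1)) : 𝔼 (n + 1))) ≠ 1) :
    lamSq k (((rhoFun n k hε hε2 y : ↥(handleTube n k)) : 𝔻 (n + 1)) : 𝔼 (n + 1)) =
      1 - sigma ε (1 - lamSq k (((y : 𝔻 (n + 1)) : 𝔼 (n + 1)))) := by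
  have ha : lamSq k (((y : 𝔻 (n + 1)) : 𝔼 (n + 1))) < 1 :=
    lt_of_le_of_ne (lamSq_le_one_handleTube n k y) hy
  have h := lamSq_psiBelt_symm n k hε hε2 y
  rw [coe_coe_psiBelt, coe_coe_handleInversionPH_symm] at h
  rw [coe_coe_rhoFun_of_ne n k hε hε2 hy, lamSq_handleInversion, h]
  · rw [h]; exact sigma_pos hε (by linarith)
  · rw [h]; exact (sigma_lt_one hε hε2 _).le

/-- `|ρ_ε(y)_λ|² > 1 - σ_ε(1)` for every `y ∈ T`. [folklore] -/
theorem lt_lamSq_rhoFun (y : ↥(handleTube n k)) :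
    1 - sigma ε 1 < lamSq k (((rhoFun n k hε hε2 y : ↥(handleTube n k)) : 𝔻 (n + 1)) : 𝔼 (n + 1)) := by
  by_cases hy : lamSq k (((y : 𝔻 (n + 1)) : 𝔼 (n + 1))) = 1
  · rw [rhoFun_of_eq_one n k hε hε2 hy, hy]
    linarith [sigma_pos hε one_pos]
  · rw [lamSq_rhoFun_of_ne n k hε hε2 hy]
    have := strictMono_sigma hε (show 1 - lamSq k (((y : 𝔻 (n + 1)) : 𝔼 (n + 1))) < 1 by
      linarith [lamSq_pos_handleTube n k y])
    linarith

/-- **`ρ_ε = id` on `{|y_λ|² > 1 - ε}`** (there `α y` lies in `{|x_λ|² < ε}` where `ψ_ε` is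
the identity, and `α α = id`). [folklore] -/
theorem rhoFun_eq_self_of_lt {y : ↥(handleTube n k)}
    (hy : 1 - ε < lamSq k (((y : 𝔻 (n + 1)) : 𝔼 (n + 1)))) : rhoFun n k hε hε2 y = y := by
  by_cases h1 : lamSq k (((y : 𝔻 (n + 1)) : 𝔼 (n + 1))) = 1
  · exact rhoFun_of_eq_one n k hε hε2 h1
  · have ha : lamSq k (((y : 𝔻 (n + 1)) : 𝔼 (n + 1))) < 1 :=
      lt_of_le_of_ne (lamSq_le_one_handleTube n k y) h1
    apply Subtype.ext; apply Subtype.ext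
    rw [coe_coe_rhoFun_of_ne n k hε hε2 h1, psi_eq_self_of_le hε,
      handleInversion_handleInversion (lamSq_pos_handleTube n k y) ha]
    rw [lamSq_handleInversion (lamSq_pos_handleTube n k y) ha.le]
    linarith

/-- **`ρ_ε⁻¹` on vectors**, for `y` off the attaching sphere with `|y_λ|² > 1 - σ_ε(1)`:
`ρ_ε⁻¹ y = α (ψ_ε⁻¹ (α y))`. [folklore] -/
theorem coe_coe_rhoInv_of_ne {y : ↥(handleTube n k)}
    (hy : lamSq k (((y : 𝔻 (n + 1)) : 𝔼 (n + 1))) ≠ 1)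
    (hyt : 1 - sigma ε 1 < lamSq k (((y : 𝔻 (n + 1)) : 𝔼 (n + 1)))) :
    (((rhoInv n k hε hε2 y : ↥(handleTube n k)) : 𝔻 (n + 1)) : 𝔼 (n + 1)) =
      handleInversion k (psiInv ε k (handleInversion k (((y : 𝔻 (n + 1)) : 𝔼 (n + 1))))) := by
  have ha : lamSq k (((y : 𝔻 (n + 1)) : 𝔼 (n + 1))) < 1 :=
    lt_of_le_of_ne (lamSq_le_one_handleTube n k y) hy
  have hb : lamSq k ((((A).symm y : ↥(beltPiece n k)) : 𝔻 (n + 1)) : 𝔼 (n + 1)) < sigma ε 1 := by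
    rw [lamSq_symm_apply]; linarith
  have hb2 : lamSq k ((((A).symm y : ↥(beltPiece n k)) : 𝔻 (n + 1)) : 𝔼 (n + 1)) < 2 * ε :=
    hb.trans (sigma_lt hε 1)
  have hb0 : 0 < lamSq k ((((A).symm y : ↥(beltPiece n k)) : 𝔻 (n + 1)) : 𝔼 (n + 1)) := by
    rw [lamSq_symm_apply]; linarith
  have hpos : lamSq k ((((psiInvBelt n k hε hε2 ((A).symm y)) : ↥(beltPiece n k)) : 𝔻 (n + 1)) :
      𝔼 (n + 1)) ≠ 0 := by
    rw [coe_coe_psiInvBelt n k hε hε2 hb, lamSq_psiInv hε hb2]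
    exact (sigmaInv_pos hε hb0 hb2).ne'
  rw [rhoInv, if_neg hy, coe_coe_handleInversionPH n k hpos, coe_coe_psiInvBelt n k hε hε2 hb,
    coe_coe_handleInversionPH_symm]

/-- **`ρ_ε⁻¹ (ρ_ε y) = y`.** [folklore] -/
theorem rhoInv_rhoFun (y : ↥(handleTube n k)) : rhoInv n k hε hε2 (rhoFun n k hε hε2 y) = y := by
  by_cases hy : lamSq k (((y : 𝔻 (n + 1)) : 𝔼 (n + 1))) = 1
  · rw [rhoFun_of_eq_one n k hε hε2 hy, rhoInv_of_eq_one n k hε hε2 hy]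
  · have ha0 := lamSq_pos_handleTube n k y
    have ha : lamSq k (((y : 𝔻 (n + 1)) : 𝔼 (n + 1))) < 1 :=
      lt_of_le_of_ne (lamSq_le_one_handleTube n k y) hy
    set z := rhoFun n k hε hε2 y with hz
    have hσ : 0 < sigma ε (1 - lamSq k (((y : 𝔻 (n + 1)) : 𝔼 (n + 1)))) :=
      sigma_pos hε (by linarith)
    have hz1 : lamSq k (((z : 𝔻 (n + 1)) : 𝔼 (n + 1))) ≠ 1 := by
      rw [hz, lamSq_rhoFun_of_ne n k hε hε2 hy]; linarith
    have hzt : 1 - sigma ε 1 < lamSq k (((z : 𝔻 (n + 1)) : 𝔼 (n + 1))) :=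
      lt_lamSq_rhoFun n k hε hε2 y
    apply Subtype.ext; apply Subtype.ext
    rw [coe_coe_rhoInv_of_ne n k hε hε2 hz1 hzt, hz, coe_coe_rhoFun_of_ne n k hε hε2 hy]
    -- `α α = id` on the squeezed point, `ψ⁻¹ ψ = id`, `α α = id`
    set v := handleInversion k (((y : 𝔻 (n + 1)) : 𝔼 (n + 1))) with hv
    have hv1 : lamSq k v = 1 - lamSq k (((y : 𝔻 (n + 1)) : 𝔼 (n + 1))) :=
      lamSq_handleInversion ha0 ha.le
    have hw0 : 0 < lamSq k (psi ε k v) := by rw [lamSq_psi hε, hv1]; exact hσ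
    have hw1 : lamSq k (psi ε k v) < 1 := by rw [lamSq_psi hε]; exact sigma_lt_one hε hε2 _
    rw [handleInversion_handleInversion hw0 hw1, psiInv_psi hε hε2 (by rw [hv1]; linarith), hv,
      handleInversion_handleInversion ha0 ha]

/-- **`ρ_ε (ρ_ε⁻¹ y) = y` on the target `{|y_λ|² > 1 - σ_ε(1)}`.** [folklore] -/
theorem rhoFun_rhoInv {y : ↥(handleTube n k)}
    (hyt : 1 - sigma ε 1 < lamSq k (((y : 𝔻 (n + 1)) : 𝔼 (n + 1)))) :
    rhoFun n k hε hε2 (rhoInv n k hε hε2 y) = y := by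
  by_cases hy : lamSq k (((y : 𝔻 (n + 1)) : 𝔼 (n + 1))) = 1
  · rw [rhoInv_of_eq_one n k hε hε2 hy, rhoFun_of_eq_one n k hε hε2 hy]
  · have ha0 := lamSq_pos_handleTube n k y
    have ha : lamSq k (((y : 𝔻 (n + 1)) : 𝔼 (n + 1))) < 1 :=
      lt_of_le_of_ne (lamSq_le_one_handleTube n k y) hy
    set v := handleInversion k (((y : 𝔻 (n + 1)) : 𝔼 (n + 1))) with hv
    have hv1 : lamSq k v = 1 - lamSq k (((y : 𝔻 (n + 1)) : 𝔼 (n + 1))) :=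
      lamSq_handleInversion ha0 ha.le
    have hb : lamSq k v < sigma ε 1 := by rw [hv1]; linarith
    have hb2 : lamSq k v < 2 * ε := hb.trans (sigma_lt hε 1)
    have hb0 : 0 < lamSq k v := by rw [hv1]; linarith
    have ha'0 : 0 < sigmaInv ε (lamSq k v) := sigmaInv_pos hε hb0 hb2
    have ha'1 : sigmaInv ε (lamSq k v) < 1 := sigmaInv_lt_one hε hb (lamSq_nonneg k v)
    set w := rhoInv n k hε hε2 y with hw
    have hwv : (((w : ↥(handleTube n k)) : 𝔻 (n + 1)) : 𝔼 (n + 1)) =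
        handleInversion k (psiInv ε k v) := by
      rw [hw, coe_coe_rhoInv_of_ne n k hε hε2 hy hyt]
    have hu0 : 0 < lamSq k (psiInv ε k v) := by rw [lamSq_psiInv hε hb2]; exact ha'0
    have hu1 : lamSq k (psiInv ε k v) < 1 := by rw [lamSq_psiInv hε hb2]; exact ha'1
    have hw1 : lamSq k (((w : 𝔻 (n + 1)) : 𝔼 (n + 1))) ≠ 1 := by
      rw [hwv, lamSq_handleInversion hu0 hu1.le]; linarith
    apply Subtype.ext; apply Subtype.ext
    rw [coe_coe_rhoFun_of_ne n k hε hε2 hw1, hwv, handleInversion_handleInversion hu0 hu1,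
      psi_psiInv hε hε2 hb2 ha'1, hv, handleInversion_handleInversion ha0 ha]

/-- **`ρ_ε` is `C^∞`** at every point of `T`: near `{|y_λ|² > 1 - ε}` it is the identity, near
a point off the attaching sphere it is the composite `α ∘ ψ_ε ∘ α` of maps `C^∞` there.
[folklore] -/
theorem contMDiffAt_rhoFun (y : ↥(handleTube n k)) :
    ContMDiffAt (𝓡∂ (n + 1)) (𝓡∂ (n + 1)) ∞ (rhoFun n k hε hε2) y := by
  by_cases hy : 1 - ε < lamSq k (((y : 𝔻 (n + 1)) : 𝔼 (n + 1)))
  · -- locally the identity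
    have hopen : IsOpen {y' : ↥(handleTube n k) | 1 - ε < lamSq k (((y' : 𝔻 (n + 1)) : 𝔼 (n + 1)))} :=
      isOpen_lt continuous_const (continuous_lamSq_handleTube n k)
    refine contMDiffAt_id.congr_of_eventuallyEq ?_
    filter_upwards [hopen.mem_nhds hy] with y' hy'
    exact rhoFun_eq_self_of_lt n k hε hε2 hy'
  · -- locally `α ∘ ψ ∘ α⁻¹`
    have hy1 : lamSq k (((y : 𝔻 (n + 1)) : 𝔼 (n + 1))) ≠ 1 := by
      intro h; rw [h] at hy; exact hy (by linarith)
    have ha : lamSq k (((y : 𝔻 (n + 1)) : 𝔼 (n + 1))) < 1 :=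
      lt_of_le_of_ne (lamSq_le_one_handleTube n k y) hy1
    have h1 : ContMDiffAt (𝓡∂ (n + 1)) (𝓡∂ (n + 1)) ∞ (A).symm y :=
      (contMDiffOn_handleInversionPH_symm n k).contMDiffAt
        ((A).open_target.mem_nhds (by exact hy1))
    have h2 : ContMDiffAt (𝓡∂ (n + 1)) (𝓡∂ (n + 1)) ∞ (psiBelt n k hε hε2) ((A).symm y) :=
      contMDiff_psiBelt n k hε hε2 _
    have hsrc : psiBelt n k hε hε2 ((A).symm y) ∈ (A).source := by
      show lamSq k _ ≠ 0
      rw [lamSq_psiBelt_symm]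
      exact (sigma_pos hε (by linarith)).ne'
    have h3 : ContMDiffAt (𝓡∂ (n + 1)) (𝓡∂ (n + 1)) ∞ A (psiBelt n k hε hε2 ((A).symm y)) :=
      (contMDiffOn_handleInversionPH n k).contMDiffAt ((A).open_source.mem_nhds hsrc)
    have hcomp : ContMDiffAt (𝓡∂ (n + 1)) (𝓡∂ (n + 1)) ∞
        (fun y' => A (psiBelt n k hε hε2 ((A).symm y'))) y := h3.comp y (h2.comp y h1)
    refine hcomp.congr_of_eventuallyEq ?_
    have hopen : IsOpen {y' : ↥(handleTube n k) | lamSq k (((y' : 𝔻 (n + 1)) : 𝔼 (n + 1))) < 1} :=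
      isOpen_lt (continuous_lamSq_handleTube n k) continuous_const
    filter_upwards [hopen.mem_nhds ha] with y' hy'
    have : lamSq k (((y' : 𝔻 (n + 1)) : 𝔼 (n + 1))) ≠ 1 := ne_of_lt hy'
    rw [rhoFun, if_neg this]

/-- **`ρ_ε⁻¹` is `C^∞`** at every point of the target `{|y_λ|² > 1 - σ_ε(1)}`. [folklore] -/
theorem contMDiffAt_rhoInv {y : ↥(handleTube n k)}
    (hyt : 1 - sigma ε 1 < lamSq k (((y : 𝔻 (n + 1)) : 𝔼 (n + 1)))) :
    ContMDiffAt (𝓡∂ (n + 1)) (𝓡∂ (n + 1)) ∞ (rhoInv n k hε hε2) y := by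
  have hε1 : ε < 1 := by linarith
  by_cases hy : 1 - ε < lamSq k (((y : 𝔻 (n + 1)) : 𝔼 (n + 1)))
  · -- locally the identity
    have hopen : IsOpen ({y' : ↥(handleTube n k) | 1 - ε < lamSq k (((y' : 𝔻 (n + 1)) : 𝔼 (n + 1)))} ∩
        {y' | 1 - sigma ε 1 < lamSq k (((y' : 𝔻 (n + 1)) : 𝔼 (n + 1)))}) :=
      (isOpen_lt continuous_const (continuous_lamSq_handleTube n k)).inter
        (isOpen_lt continuous_const (continuous_lamSq_handleTube n k))
    refine contMDiffAt_id.congr_of_eventuallyEq ?_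
    filter_upwards [hopen.mem_nhds ⟨hy, hyt⟩] with y' hy'
    show rhoInv n k hε hε2 y' = y'
    by_cases h1 : lamSq k (((y' : 𝔻 (n + 1)) : 𝔼 (n + 1))) = 1
    · exact rhoInv_of_eq_one n k hε hε2 h1
    · have ha0 := lamSq_pos_handleTube n k y'
      have ha : lamSq k (((y' : 𝔻 (n + 1)) : 𝔼 (n + 1))) < 1 :=
        lt_of_le_of_ne (lamSq_le_one_handleTube n k y') h1
      have hlt : 1 - ε < lamSq k (((y' : 𝔻 (n + 1)) : 𝔼 (n + 1))) := hy'.1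
      have hyt' : 1 - sigma ε 1 < lamSq k (((y' : 𝔻 (n + 1)) : 𝔼 (n + 1))) := hy'.2
      apply Subtype.ext; apply Subtype.ext
      rw [coe_coe_rhoInv_of_ne n k hε hε2 h1 hyt', psiInv_eq_self_of_le hε,
        handleInversion_handleInversion ha0 ha]
      rw [lamSq_handleInversion ha0 ha.le]
      linarith
  · have hy1 : lamSq k (((y : 𝔻 (n + 1)) : 𝔼 (n + 1))) ≠ 1 := by
      intro h; rw [h] at hy; exact hy (by linarith)
    have ha0 := lamSq_pos_handleTube n k y
    have ha : lamSq k (((y : 𝔻 (n + 1)) : 𝔼 (n + 1))) < 1 :=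
      lt_of_le_of_ne (lamSq_le_one_handleTube n k y) hy1
    have h1 : ContMDiffAt (𝓡∂ (n + 1)) (𝓡∂ (n + 1)) ∞ (A).symm y :=
      (contMDiffOn_handleInversionPH_symm n k).contMDiffAt
        ((A).open_target.mem_nhds (by exact hy1))
    have hb : lamSq k ((((A).symm y : ↥(beltPiece n k)) : 𝔻 (n + 1)) : 𝔼 (n + 1)) < sigma ε 1 := by
      rw [lamSq_symm_apply]; linarith
    have hb2 := hb.trans (sigma_lt hε 1)
    have hb0 : 0 < lamSq k ((((A).symm y : ↥(beltPiece n k)) : 𝔻 (n + 1)) : 𝔼 (n + 1)) := by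
      rw [lamSq_symm_apply]; linarith
    have hopenB : IsOpen {b : ↥(beltPiece n k) | lamSq k (((b : 𝔻 (n + 1)) : 𝔼 (n + 1))) < sigma ε 1} :=
      isOpen_lt (continuous_lamSq_beltPiece n k) continuous_const
    have h2 : ContMDiffAt (𝓡∂ (n + 1)) (𝓡∂ (n + 1)) ∞ (psiInvBelt n k hε hε2) ((A).symm y) :=
      (contMDiffOn_psiInvBelt n k hε hε2).contMDiffAt (hopenB.mem_nhds hb)
    have hsrc : psiInvBelt n k hε hε2 ((A).symm y) ∈ (A).source := by
      show lamSq k _ ≠ 0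
      rw [coe_coe_psiInvBelt n k hε hε2 hb, lamSq_psiInv hε hb2]
      exact (sigmaInv_pos hε hb0 hb2).ne'
    have h3 : ContMDiffAt (𝓡∂ (n + 1)) (𝓡∂ (n + 1)) ∞ A (psiInvBelt n k hε hε2 ((A).symm y)) :=
      (contMDiffOn_handleInversionPH n k).contMDiffAt ((A).open_source.mem_nhds hsrc)
    have hcomp : ContMDiffAt (𝓡∂ (n + 1)) (𝓡∂ (n + 1)) ∞
        (fun y' => A (psiInvBelt n k hε hε2 ((A).symm y'))) y := h3.comp y (h2.comp y h1)
    refine hcomp.congr_of_eventuallyEq ?_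
    have hopen : IsOpen {y' : ↥(handleTube n k) | lamSq k (((y' : 𝔻 (n + 1)) : 𝔼 (n + 1))) < 1} :=
      isOpen_lt (continuous_lamSq_handleTube n k) continuous_const
    filter_upwards [hopen.mem_nhds ha] with y' hy'
    have : lamSq k (((y' : 𝔻 (n + 1)) : 𝔼 (n + 1))) ≠ 1 := ne_of_lt hy'
    rw [rhoInv, if_neg this]

/-- **The reparametrisation `ρ_ε : T → T`** as an open partial homeomorphism of `T` with source
everything and target `{|y_λ|² > 1 - σ_ε(1)}`, inverse `α ∘ ψ_ε⁻¹ ∘ α`. [folklore] -/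
def rho : OpenPartialHomeomorph ↥(handleTube n k) ↥(handleTube n k) where
  toFun := rhoFun n k hε hε2
  invFun := rhoInv n k hε hε2
  source := univ
  target := {y | 1 - sigma ε 1 < lamSq k (((y : 𝔻 (n + 1)) : 𝔼 (n + 1)))}
  map_source' y _ := lt_lamSq_rhoFun n k hε hε2 y
  map_target' _ _ := mem_univ _
  left_inv' y _ := rhoInv_rhoFun n k hε hε2 y
  right_inv' _ hy := rhoFun_rhoInv n k hε hε2 hy
  open_source := isOpen_univ
  open_target := isOpen_lt continuous_const (continuous_lamSq_handleTube n k)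
  continuousOn_toFun := fun y _ => (contMDiffAt_rhoFun n k hε hε2 y).continuousAt.continuousWithinAt
  continuousOn_invFun := fun _ hy => (contMDiffAt_rhoInv n k hε hε2 hy).continuousAt.continuousWithinAt

/-- The source of `ρ_ε` is everything. [folklore] -/
@[simp] theorem rho_source : (rho n k hε hε2).source = univ := rfl

/-- The target of `ρ_ε` is `{|y_λ|² > 1 - σ_ε(1)}`. [folklore] -/
@[simp] theorem rho_target :
    (rho n k hε hε2).target =
      {y : ↥(handleTube n k) | 1 - sigma ε 1 < lamSq k (((y : 𝔻 (n + 1)) : 𝔼 (n + 1)))} := rfl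

/-- `ρ_ε` on points is `rhoFun`. [folklore] -/
theorem rho_apply (y : ↥(handleTube n k)) : rho n k hε hε2 y = rhoFun n k hε hε2 y := rfl

/-- **`ρ_ε` is `C^∞` on its source.** [folklore] -/
theorem contMDiffOn_rho :
    ContMDiffOn (𝓡∂ (n + 1)) (𝓡∂ (n + 1)) ∞ (rho n k hε hε2) (rho n k hε hε2).source :=
  fun y _ => (contMDiffAt_rhoFun n k hε hε2 y).contMDiffWithinAt

/-- **`ρ_ε⁻¹` is `C^∞` on the target.** [folklore] -/
theorem contMDiffOn_rho_symm :
    ContMDiffOn (𝓡∂ (n + 1)) (𝓡∂ (n + 1)) ∞ (rho n k hε hε2).symm (rho n k hε hε2).target :=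
  fun _ hy => (contMDiffAt_rhoInv n k hε hε2 hy).contMDiffWithinAt

/-- **`ρ_ε` preserves the boundary sphere**: `‖ρ_ε y‖ = 1 ↔ ‖y‖ = 1` (`α` and `ψ_ε` do).
[folklore] -/
theorem norm_rho_eq_one_iff (y : ↥(handleTube n k)) :
    ‖(((rho n k hε hε2 y : ↥(handleTube n k)) : 𝔻 (n + 1)) : 𝔼 (n + 1))‖ = 1 ↔
      ‖(((y : 𝔻 (n + 1)) : 𝔼 (n + 1)))‖ = 1 := by
  rw [rho_apply]
  by_cases hy : lamSq k (((y : 𝔻 (n + 1)) : 𝔼 (n + 1))) = 1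
  · rw [rhoFun_of_eq_one n k hε hε2 hy]
  · have ha0 := lamSq_pos_handleTube n k y
    have hu1 : ‖(((y : 𝔻 (n + 1)) : 𝔼 (n + 1)))‖ ≤ 1 := mem_closedBall_zero_iff.1 (y : 𝔻 (n + 1)).2
    have ha : lamSq k (((y : 𝔻 (n + 1)) : 𝔼 (n + 1))) < 1 :=
      lt_of_le_of_ne (lamSq_le_one_handleTube n k y) hy
    set v := handleInversion k (((y : 𝔻 (n + 1)) : 𝔼 (n + 1))) with hv
    have hv1 : lamSq k v = 1 - lamSq k (((y : 𝔻 (n + 1)) : 𝔼 (n + 1))) :=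
      lamSq_handleInversion ha0 ha.le
    have hvn : ‖v‖ ≤ 1 := norm_handleInversion_le_one hu1 ha0 ha
    have hvl : lamSq k v < 1 := by rw [hv1]; linarith
    have hw0 : 0 < lamSq k (psi ε k v) := by
      rw [lamSq_psi hε, hv1]; exact sigma_pos hε (by linarith)
    have hw1 : lamSq k (psi ε k v) < 1 := by rw [lamSq_psi hε]; exact sigma_lt_one hε hε2 _
    have hwn : ‖psi ε k v‖ ≤ 1 := norm_psi_le_one hε hε2 hvn hvl
    rw [coe_coe_rhoFun_of_ne n k hε hε2 hy, norm_handleInversion_eq_one_iff hwn hw0 hw1,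
      norm_psi_eq_one_iff hε hε2 hvn hvl, hv, norm_handleInversion_eq_one_iff hu1 ha0 ha]

omit hε2 [Nonempty ↥(handleTube n k)] in
/-- `σ_ε(1) < 2ε`. [folklore] -/
theorem sigma_one_lt : sigma ε 1 < 2 * ε := sigma_lt hε 1

end Pieces

end HandleShrink

/-! ### §4 Shrunken attaching maps -/

namespace HandleAttachingMap

variable {n k : ℕ} {M : Type u} [TopologicalSpace M] [ChartedSpace (EuclideanHalfSpace (n + 1)) M]
  {ε : ℝ} [Nonempty ↥(handleTube n k)]

/-- **The shrunken attaching map `h̄ ∘ ρ_ε`** (`0 < ε`, `2ε ≤ 1`): an attaching map with the same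
germ at the attaching sphere as `h̄` (`shrink_apply_of_lt`: it agrees with `h̄` on
`{|y_λ|² > 1 - ε}`), whose range is the thin neighbourhood `h̄({|y_λ|² > 1 - σ_ε(1)})` of the
attaching sphere (`range_shrink`, with `σ_ε(1) < 2ε`).  It is a smooth embedding with open range
because `ρ_ε` is a globally defined partial diffeomorphism of `T`
(`IsSmoothEmbedding.comp_openPartialHomeomorph`), and it sends `T ∩ ∂Dᵐ` into `∂M` because `ρ_ε`
preserves the boundary sphere (`HandleShrink.norm_rho_eq_one_iff`).  By locality the attachments
along `h̄ ∘ ρ_ε` and along `h̄` are the same (`isMultiAttachment_shrink_iff`).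
[cite: Kosinski1993, VI §6 with VI §1 (proof of (1.1))] -/
def shrink (h : HandleAttachingMap n k M) (hε : 0 < ε) (hε2 : 2 * ε ≤ 1) :
    HandleAttachingMap n k M where
  toFun := h.toFun ∘ HandleShrink.rho n k hε hε2
  isSmoothEmbedding :=
    h.isSmoothEmbedding.comp_openPartialHomeomorph (HandleShrink.rho n k hε hε2) rfl
      (HandleShrink.contMDiffOn_rho n k hε hε2) (HandleShrink.contMDiffOn_rho_symm n k hε hε2)
  isOpen_range := by
    rw [OpenPartialHomeomorph.range_comp_eq_image_target _ rfl]
    exact h.isOpenMap_toFun _ (HandleShrink.rho n k hε hε2).open_target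
  isBoundaryPoint y hy :=
    h.isBoundaryPoint _ ((HandleShrink.norm_rho_eq_one_iff n k hε hε2 y).2 hy)

variable (h : HandleAttachingMap n k M) (hε : 0 < ε) (hε2 : 2 * ε ≤ 1)

/-- The shrunken attaching map on points. [folklore] -/
theorem shrink_apply (y : ↥(handleTube n k)) :
    (h.shrink hε hε2).toFun y = h.toFun (HandleShrink.rhoFun n k hε hε2 y) := rfl

/-- **Same germ at the attaching sphere**: `h̄ ∘ ρ_ε = h̄` on `{|y_λ|² > 1 - ε}`. [folklore] -/
theorem shrink_apply_of_lt {y : ↥(handleTube n k)}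
    (hy : 1 - ε < lamSq k (((y : 𝔻 (n + 1)) : 𝔼 (n + 1)))) :
    (h.shrink hε hε2).toFun y = h.toFun y := by
  rw [shrink_apply, HandleShrink.rhoFun_eq_self_of_lt n k hε hε2 hy]

/-- In particular `h̄ ∘ ρ_ε = h̄` on the attaching sphere. [folklore] -/
theorem shrink_apply_of_eq_one {y : ↥(handleTube n k)}
    (hy : lamSq k (((y : 𝔻 (n + 1)) : 𝔼 (n + 1))) = 1) : (h.shrink hε hε2).toFun y = h.toFun y :=
  h.shrink_apply_of_lt hε hε2 (by rw [hy]; linarith)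

/-- **The range of the shrunken map is the thin tube `h̄({|y_λ|² > 1 - σ_ε(1)})`.** [folklore] -/
theorem range_shrink : range (h.shrink hε hε2).toFun =
    h.toFun '' {y | 1 - HandleShrink.sigma ε 1 < lamSq k (((y : 𝔻 (n + 1)) : 𝔼 (n + 1)))} :=
  OpenPartialHomeomorph.range_comp_eq_image_target _ rfl _

/-- The range of the shrunken map lies in `h̄({|y_λ|² > 1 - 2ε})`. [folklore] -/
theorem range_shrink_subset : range (h.shrink hε hε2).toFun ⊆
    h.toFun '' {y | 1 - 2 * ε < lamSq k (((y : 𝔻 (n + 1)) : 𝔼 (n + 1)))} := by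
  rw [range_shrink]
  refine image_mono fun y hy => ?_
  have h1 := HandleShrink.sigma_one_lt hε
  simp only [mem_setOf_eq] at hy ⊢
  linarith

/-- The range of the shrunken map lies in the range of `h̄`. [folklore] -/
theorem range_shrink_subset_range : range (h.shrink hε hε2).toFun ⊆ range h.toFun := by
  rw [range_shrink]; exact image_subset_range _ _

/-- **The attaching sphere is unchanged.** [folklore] -/
theorem core_shrink : (h.shrink hε hε2).core = h.core := by
  ext a
  simp only [mem_core_iff]
  constructor
  · rintro ⟨y, hy, rfl⟩
    exact ⟨y, hy, (h.shrink_apply_of_eq_one hε hε2 hy).symm⟩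
  · rintro ⟨y, hy, rfl⟩
    exact ⟨y, hy, h.shrink_apply_of_eq_one hε hε2 hy⟩

/-- **A point of `∂M` in the range of `h̄` but outside the closure of the shrunken range**,
with a neighbourhood missing the shrunken range: `h̄(y₀)` for any `y₀ ∈ T ∩ ∂Dᵐ` with
`|y₀,λ|² < 1 - 2ε`, the neighbourhood being `h̄({|y_λ|² < 1 - 2ε})` (room next to a shrunken
handle, e.g. for the birth of a cancelling pair). [folklore] -/
theorem disjoint_image_range_shrink :
    Disjoint (h.toFun '' {y | lamSq k (((y : 𝔻 (n + 1)) : 𝔼 (n + 1))) < 1 - 2 * ε})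
      (range (h.shrink hε hε2).toFun) := by
  refine Set.disjoint_left.2 ?_
  rintro _ ⟨y, hy, rfl⟩ hmem
  obtain ⟨y', hy', he⟩ := h.range_shrink_subset hε hε2 hmem
  have := h.injective he
  subst this
  simp only [mem_setOf_eq] at hy hy'
  linarith

variable {h}

/-- Shrunken families with pairwise disjoint ranges stay pairwise disjoint. [folklore] -/
theorem pairwise_disjoint_range_shrink {ι : Type*} {h : ι → HandleAttachingMap n k M}
    (hd : Pairwise fun i j => Disjoint (range (h i).toFun) (range (h j).toFun)) :
    Pairwise fun i j => Disjoint (range ((h i).shrink hε hε2).toFun)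
      (range ((h j).shrink hε hε2).toFun) := fun _ _ hij =>
  (hd hij).mono (range_shrink_subset_range _ hε hε2) (range_shrink_subset_range _ hε hε2)

/-- **Shrinking does not change the attachments** (locality, Kosinski VI §1/§6): `P` is `M`
with handles attached along the shrunken maps `h̄ᵢ ∘ ρ_ε` iff it is `M` with handles attached
along the `h̄ᵢ`. [cite: Kosinski1993, VI §6 with VI §1 (proof of (1.1))] -/
theorem isMultiAttachment_shrink_iff [T2Space M] [IsManifold (𝓡∂ (n + 1)) ∞ M] {ι : Type*}
    [Finite ι] {h : ι → HandleAttachingMap n k M}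
    (hd : Pairwise fun i j => Disjoint (range (h i).toFun) (range (h j).toFun))
    {P : Type*} [TopologicalSpace P] [ChartedSpace (EuclideanHalfSpace (n + 1)) P]
    [IsManifold (𝓡∂ (n + 1)) ∞ P] :
    IsMultiAttachment (fun i => (h i).shrink hε hε2) (𝓡∂ (n + 1)) P ↔
      IsMultiAttachment h (𝓡∂ (n + 1)) P :=
  isMultiAttachment_iff_of_eqOn_near_sphere hε (fun i _ hy => (h i).shrink_apply_of_lt hε hε2 hy)
    (pairwise_disjoint_range_shrink hε hε2 hd) hd

end HandleAttachingMap

end Literature.Topology.FourManifolds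

end
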